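import Literature.Analysis.FluidPDE.NewtonLocalPotential
import Literature.Analysis.FluidPDE.BiotSavartNewtonKernel
import Literature.Analysis.FluidPDE.HelmholtzAnnihilator
import Literature.Analysis.FluidPDE.WholeSpaceIBP
import HarnessLib

/-!
# The Newtonian potential of a test function, and pairings of weakly divergence-free fields
with bounded gradients

Analysis/FluidPDE support file (all results proved, no definitions) on the decomposition path of
the named fact `Literature.Analysis.FluidPDE.biotSavart_curl_eq_self` (`Vorticity.lean`;
Majda–Bertozzi, *Vorticity and Incompressible Flow*, §2.4.1 Prop. 2.16), a brick of
`Literature.Analysis.FluidPDE.MajdaBertozzi2002_holderEulerUniqueness`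
(`ElgindiAprioriBlowupProofs.lean`). It supplies the last input of the curl-type pairing of a
Biot–Savart velocity (`BiotSavartCurlPair.integral_inner_biotSavart_curlPair_eq`): the term
`∫ ⟪ω(y), ∫ ∂_{V₀}Γ(y − x) ∇g(x) dx⟫ dy` vanishes when `ω ∈ L¹` is weakly divergence free.

* `IsWeaklyDivFree.integral_inner_gradient_eq_zero_of_bounded` — **a weakly divergence-free
  `L¹` field annihilates every bounded smooth gradient with bounded derivative** (general
  finite-dimensional inner product space; truncation by the tree's `cutoff R`, whose gradient is
  `O(1/R)`, and dominated convergence).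
* The Newtonian potential `y ↦ ∫ Γ(y − x) G(x) dx` of a test function `G`: it agrees near every
  point with a truncated potential `newtonNearPotential r₀ r₁ G` of the tree
  (`integral_newtonKernel_mul_eq_newtonNearPotential`), hence is `C^∞`
  (`contDiff_integral_newtonKernel_mul`) with `∂ₐ ∫ Γ(y − x) G(x) dx = ∫ Γ(y − x) ∂ₐG(x) dx`
  (`fderiv_integral_newtonKernel_mul_apply`); it is bounded by `‖G‖_∞ + (4π)⁻¹‖G‖_{L¹}`
  (`abs_integral_newtonKernel_mul_le`) with gradient bounded by `‖DG‖_∞ + (4π)⁻¹‖DG‖_{L¹}`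
  (`norm_fderiv_integral_newtonKernel_mul_le`).
* `integral_fderiv_newtonKernel_smul_gradient_eq_gradient` —
  `∫ ∂_{V₀}Γ(y − x) ∇g(x) dx = ∇(Γ * ∂_{V₀}g)(y)` (the distributional-gradient identity of
  `BiotSavartNewtonKernel.lean` and the symmetry of second derivatives), and the conclusion
  `IsWeaklyDivFree.integral_inner_integral_fderiv_newtonKernel_smul_gradient_eq_zero`.

## References

* A. J. Majda, A. L. Bertozzi, *Vorticity and Incompressible Flow* (CUP 2002), §2.4.1
  Prop. 2.16 (p. 63–64 of the held text). [MajdaBertozziCUP2002]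
* D. Gilbarg, N. S. Trudinger, *Elliptic partial differential equations of second order*
  (2001), Lemma 4.1 (derivatives of the Newtonian potential). [GilbargTrudinger2001]
-/

noncomputable section

open MeasureTheory Set Filter Topology Function Metric InnerProductSpace
open scoped ENNReal NNReal RealInnerProductSpace

namespace Literature.Analysis.FluidPDE

/-! ### Weakly divergence-free `L¹` fields annihilate bounded gradients -/

section Cutoff

variable {E : Type*} [NormedAddCommGroup E] [InnerProductSpace ℝ E] [FiniteDimensional ℝ E]
  [MeasurableSpace E] [BorelSpace E]

omit [MeasurableSpace E] [BorelSpace E] in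
/-- `‖∇f(x)‖ = ‖Df(x)‖` (a private copy of the tree's `norm_gradient_eq_norm_fderiv`,
`SchefferTestFunction.lean`, not imported here). [folklore] -/
private theorem norm_gradient_eq_norm_fderiv' (f : E → ℝ) (x : E) :
    ‖gradient f x‖ = ‖fderiv ℝ f x‖ := by
  rw [gradient, LinearIsometryEquiv.norm_map]

/-- **A weakly divergence-free integrable field annihilates every bounded smooth gradient.** If
`ω ∈ L¹(E; E)` satisfies `∫ ⟪ω, ∇θ⟫ = 0` for all test functions `θ`, then `∫ ⟪ω, ∇Θ⟫ = 0` for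
every `Θ ∈ C^∞` with `Θ` and `DΘ` bounded: test with `θ_R = χ_R Θ` (`χ_R = cutoff R`, gradient
`O(1/R)`) and let `R → ∞` by dominated convergence (`∇θ_R = χ_R ∇Θ + Θ ∇χ_R → ∇Θ` pointwise,
`|⟪ω, ∇θ_R⟫| ≤ (B₁ + B₀C) |ω|`). [folklore] -/
theorem IsWeaklyDivFree.integral_inner_gradient_eq_zero_of_bounded {ω : E → E}
    (hωi : Integrable ω) (hdiv : IsWeaklyDivFree ω) {Θ : E → ℝ} (hΘ : ContDiff ℝ (⊤ : ℕ∞) Θ)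
    {B₀ B₁ : ℝ} (hB₀ : ∀ x, |Θ x| ≤ B₀) (hB₁ : ∀ x, ‖fderiv ℝ Θ x‖ ≤ B₁) :
    ∫ x, ⟪ω x, gradient Θ x⟫ = 0 := by
  obtain ⟨Cχ, hCχ0, hCχ⟩ := exists_norm_fderiv_cutoff_le (E := E)
  have hB00 : 0 ≤ B₀ := (abs_nonneg _).trans (hB₀ 0)
  have hB10 : 0 ≤ B₁ := (norm_nonneg _).trans (hB₁ 0)
  have hΘ1 : ContDiff ℝ 1 Θ := contDiff_infty.1 hΘ 1
  have hdΘ : Differentiable ℝ Θ := hΘ1.differentiable one_ne_zero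
  -- the truncations `θₙ = χ_{n+1} Θ`
  set R : ℕ → ℝ := fun n => (n : ℝ) + 1 with hR
  have hR0 : ∀ n, 0 < R n := fun n => by positivity
  have hR1 : ∀ n, 1 ≤ R n := fun n => by simp [hR]
  set θ : ℕ → E → ℝ := fun n x => cutoff (R n) x * Θ x with hθ
  have hθt : ∀ n, FunctionSpaces.IsTestFunctionOn (⊤ : TopologicalSpace.Opens E) (θ n) := fun n =>
    ⟨(contDiff_cutoff (R n)).mul hΘ, (hasCompactSupport_cutoff (hR0 n)).mul_right,
      fun _ _ => trivial⟩
  have hzero : ∀ n, ∫ x, ⟪ω x, gradient (θ n) x⟫ = 0 := fun n => hdiv _ (hθt n)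
  -- gradients of the truncations
  have hdc : ∀ n, Differentiable ℝ (cutoff (E := E) (R n)) := fun n =>
    (contDiff_cutoff (n := 1) (R n)).differentiable one_ne_zero
  have hgrad : ∀ n x, gradient (θ n) x =
      cutoff (R n) x • gradient Θ x + Θ x • gradient (cutoff (R n)) x := fun n x => by
    simp only [hθ, gradient, fderiv_fun_mul (hdc n x) (hdΘ x), map_add, map_smul]
  -- dominated convergence
  have hlim : Tendsto (fun n => ∫ x, ⟪ω x, gradient (θ n) x⟫) atTop
      (𝓝 (∫ x, ⟪ω x, gradient Θ x⟫)) := by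
    refine tendsto_integral_of_dominated_convergence (fun x => ‖ω x‖ * (B₁ + B₀ * Cχ))
      (fun n => ?_) (hωi.norm.mul_const _) (fun n => Eventually.of_forall fun x => ?_) ?_
    · exact hωi.aestronglyMeasurable.inner (FluidPDE.continuous_gradient_of_contDiff
        (contDiff_infty.1 (hθt n).contDiff 1)).aestronglyMeasurable
    · -- the bound `|⟪ω, ∇θₙ⟫| ≤ |ω| (B₁ + B₀ C)`
      refine (norm_inner_le_norm _ _).trans (mul_le_mul_of_nonneg_left ?_ (norm_nonneg _))
      rw [hgrad]
      refine (norm_add_le _ _).trans (add_le_add ?_ ?_)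
      · rw [norm_smul, norm_gradient_eq_norm_fderiv']
        calc ‖cutoff (R n) x‖ * ‖fderiv ℝ Θ x‖ ≤ 1 * B₁ :=
              mul_le_mul (by simpa using abs_cutoff_le_one (R n) x) (hB₁ x) (norm_nonneg _)
                zero_le_one
          _ = B₁ := one_mul _
      · rw [norm_smul, norm_gradient_eq_norm_fderiv', Real.norm_eq_abs]
        refine mul_le_mul (hB₀ x) ((hCχ (R n) (hR0 n) x).trans (div_le_self hCχ0 (hR1 n)))
          (norm_nonneg _) hB00
    · -- pointwise convergence: eventually `∇θₙ(x) = ∇Θ(x)`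
      refine Eventually.of_forall fun x => tendsto_const_nhds.congr' ?_
      refine (eventually_gt_atTop (⌈‖x‖⌉₊ : ℕ)).mono fun n hn => ?_
      have hxR : ‖x‖ < R n := by
        have : (⌈‖x‖⌉₊ : ℝ) < n := by exact_mod_cast hn
        have h2 := Nat.le_ceil ‖x‖
        simp only [hR]
        linarith
      have hev : cutoff (E := E) (R n) =ᶠ[𝓝 x] fun _ => 1 := by
        have : Metric.ball x (R n - ‖x‖) ∈ 𝓝 x := Metric.ball_mem_nhds x (by linarith)
        filter_upwards [this] with w hw
        refine cutoff_eq_one (hR0 n) ?_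
        have h1 : ‖w - x‖ < R n - ‖x‖ := by rwa [mem_ball, dist_eq_norm] at hw
        calc ‖w‖ = ‖(w - x) + x‖ := by rw [sub_add_cancel]
          _ ≤ ‖w - x‖ + ‖x‖ := norm_add_le _ _
          _ ≤ R n := by linarith
      have h1 : cutoff (R n) x = 1 := hev.eq_of_nhds
      have h2 : gradient (cutoff (E := E) (R n)) x = 0 := by
        rw [gradient, hev.fderiv_eq]
        simp
      show ⟪ω x, gradient Θ x⟫ = ⟪ω x, gradient (θ n) x⟫
      rw [hgrad, h1, h2, one_smul, smul_zero, add_zero]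
  have h0 : Tendsto (fun n => ∫ x, ⟪ω x, gradient (θ n) x⟫) atTop (𝓝 0) := by
    simp_rw [hzero]
    exact tendsto_const_nhds
  exact tendsto_nhds_unique hlim h0

end Cutoff

/-! ### The Newtonian potential of a test function -/

section Potential

variable {G : EuclideanSpace ℝ (Fin 3) → ℝ}

/-- **Local agreement with the truncated potential.** For `G` supported in `B̄(0, R)` and `y` in the
unit ball around `y₀`, `∫ Γ(y − x) G(x) dx = N[G](y)` with the tree's truncated potential
`N = newtonNearPotential r₀ r₁`, `r₀ = ‖y₀‖ + |R| + 2` (on the relevant `z = y − x` the truncated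
kernel `Γ₀` is the Newtonian kernel). [folklore] -/
theorem integral_newtonKernel_mul_eq_newtonNearPotential (hGc : HasCompactSupport G) {R : ℝ}
    (hR : tsupport G ⊆ closedBall (0 : EuclideanSpace ℝ (Fin 3)) R) (y₀ : EuclideanSpace ℝ (Fin 3))
    {y : EuclideanSpace ℝ (Fin 3)} (hy : y ∈ ball y₀ 1) :
    ∫ x, newtonKernel (y - x) * G x =
      newtonNearPotential (‖y₀‖ + |R| + 2) (‖y₀‖ + |R| + 3) G y := by
  have h₀ : (0 : ℝ) ≤ ‖y₀‖ + |R| + 2 := by positivity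
  have h₁ : ‖y₀‖ + |R| + 2 < ‖y₀‖ + |R| + 3 := by linarith
  have _ := hGc
  rw [newtonNearPotential_apply]
  have hpt : ∀ z, newtonNear (‖y₀‖ + |R| + 2) (‖y₀‖ + |R| + 3) z * G (y - z) =
      newtonKernel z * G (y - z) := fun z => by
    by_cases hz : y - z ∈ tsupport G
    · have h1 : ‖y - z‖ ≤ R := mem_closedBall_zero_iff.1 (hR hz)
      have hy' : ‖y - y₀‖ < 1 := by rwa [mem_ball, dist_eq_norm] at hy
      have hz' : ‖z‖ ≤ ‖y₀‖ + |R| + 2 := by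
        have e : z = (y - y₀) + y₀ - (y - z) := by abel
        calc ‖z‖ = ‖(y - y₀) + y₀ - (y - z)‖ := by rw [← e]
          _ ≤ ‖(y - y₀) + y₀‖ + ‖y - z‖ := norm_sub_le _ _
          _ ≤ ‖y - y₀‖ + ‖y₀‖ + ‖y - z‖ := by linarith [norm_add_le (y - y₀) y₀]
          _ ≤ ‖y₀‖ + |R| + 2 := by linarith [le_abs_self R]
      rw [newtonNear_eq_newtonKernel h₀ h₁ hz']
    · rw [image_eq_zero_of_notMem_tsupport hz, mul_zero, mul_zero]
  simp_rw [hpt]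
  have h := integral_sub_left_eq_self (fun x => newtonKernel (y - x) * G x) volume y
  simp only [sub_sub_cancel] at h
  exact h.symm

/-- **The Newtonian potential of a test function is smooth** (it agrees near every point with a
truncated potential `N[G]`, which is `C^∞`, `contDiff_newtonNearPotential_top`). [folklore] -/
theorem contDiff_integral_newtonKernel_mul (hG : ContDiff ℝ (⊤ : ℕ∞) G) (hGc : HasCompactSupport G) :
    ContDiff ℝ (⊤ : ℕ∞) fun y => ∫ x, newtonKernel (y - x) * G x := by
  obtain ⟨R, hR⟩ : ∃ R : ℝ, tsupport G ⊆ closedBall (0 : EuclideanSpace ℝ (Fin 3)) R :=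
    (hGc.isCompact.isBounded).subset_closedBall 0
  refine contDiff_iff_contDiffAt.2 fun y₀ => ?_
  have hev : (fun y => ∫ x, newtonKernel (y - x) * G x) =ᶠ[𝓝 y₀]
      newtonNearPotential (‖y₀‖ + |R| + 2) (‖y₀‖ + |R| + 3) G := by
    filter_upwards [ball_mem_nhds y₀ one_pos] with y hy
    exact integral_newtonKernel_mul_eq_newtonNearPotential hGc hR y₀ hy
  refine (ContDiff.contDiffAt ?_).congr_of_eventuallyEq hev
  exact contDiff_newtonNearPotential_top (by positivity) (by linarith) hG

/-- The support of a directional derivative lies in the support of the function. [folklore] -/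
theorem tsupport_fderiv_apply_subset (G : EuclideanSpace ℝ (Fin 3) → ℝ) (a : EuclideanSpace ℝ (Fin 3)) :
    tsupport (fun w => fderiv ℝ G w a) ⊆ tsupport G := by
  refine (closure_mono ?_).trans (tsupport_fderiv_subset ℝ (f := G))
  intro w hw
  rw [mem_support] at hw ⊢
  contrapose! hw
  rw [hw]
  rfl

/-- **Derivatives fall on the test function**: `∂ₐ ∫ Γ(y − x) G(x) dx = ∫ Γ(y − x) ∂ₐG(x) dx`
(locally `N[G]`, and `∂ₐN[G] = N[∂ₐG]`, `fderiv_newtonNearPotential_apply`). [folklore] -/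
theorem fderiv_integral_newtonKernel_mul_apply (hG : ContDiff ℝ (⊤ : ℕ∞) G)
    (hGc : HasCompactSupport G) (y a : EuclideanSpace ℝ (Fin 3)) :
    fderiv ℝ (fun y => ∫ x, newtonKernel (y - x) * G x) y a =
      ∫ x, newtonKernel (y - x) * fderiv ℝ G x a := by
  obtain ⟨R, hR⟩ : ∃ R : ℝ, tsupport G ⊆ closedBall (0 : EuclideanSpace ℝ (Fin 3)) R :=
    (hGc.isCompact.isBounded).subset_closedBall 0
  have hev : (fun y => ∫ x, newtonKernel (y - x) * G x) =ᶠ[𝓝 y]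
      newtonNearPotential (‖y‖ + |R| + 2) (‖y‖ + |R| + 3) G := by
    filter_upwards [ball_mem_nhds y one_pos] with y' hy'
    exact integral_newtonKernel_mul_eq_newtonNearPotential hGc hR y hy'
  rw [hev.fderiv_eq, fderiv_newtonNearPotential_apply (by positivity) (by linarith)
    (contDiff_infty.1 hG 1) y a]
  exact (integral_newtonKernel_mul_eq_newtonNearPotential (hGc.fderiv_apply (𝕜 := ℝ) a)
    ((tsupport_fderiv_apply_subset G a).trans hR) y (mem_ball_self one_pos)).symm

/-- **Sup bound for the Newtonian potential of a bounded compactly supported function**: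
`|∫ Γ(y − x) G(x) dx| ≤ B + (4π)⁻¹ ‖G‖_{L¹}` for `|G| ≤ B` (split `(4π|w|)⁻¹` at `|w| = 1`:
`≤ (4π)⁻¹ |w|⁻²` inside, `≤ (4π)⁻¹` outside; `∫ 1_{|w|<1}|w|⁻² = 4π`). [folklore] -/
theorem abs_integral_newtonKernel_mul_le (hG : Continuous G) (hGc : HasCompactSupport G) {B : ℝ}
    (hB : ∀ x, |G x| ≤ B) (y : EuclideanSpace ℝ (Fin 3)) :
    |∫ x, newtonKernel (y - x) * G x| ≤ B + (4 * Real.pi)⁻¹ * ∫ x, |G x| := by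
  have hB0 : 0 ≤ B := (abs_nonneg _).trans (hB 0)
  have hGi : Integrable G := hG.integrable_of_hasCompactSupport hGc
  have hmaj : Integrable fun x : EuclideanSpace ℝ (Fin 3) =>
      (4 * Real.pi)⁻¹ * (B * nearProfile₂ 1 ‖y - x‖ + |G x|) :=
    ((((integrable_nearProfile₂_norm one_pos).comp_sub_left y).const_mul B).add hGi.abs).const_mul _
  have hpt : ∀ x, |newtonKernel (y - x) * G x| ≤
      (4 * Real.pi)⁻¹ * (B * nearProfile₂ 1 ‖y - x‖ + |G x|) := fun x => by
    rw [abs_mul, abs_newtonKernel]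
    unfold nearProfile₂
    by_cases h1 : ‖y - x‖ < 1
    · rw [if_pos h1]
      have hle : (4 * Real.pi * ‖y - x‖)⁻¹ ≤ (4 * Real.pi)⁻¹ * (‖y - x‖ ^ 2)⁻¹ := by
        rcases eq_or_ne (y - x) 0 with h0 | h0
        · rw [h0]; simp
        · have hp : 0 < ‖y - x‖ := norm_pos_iff.2 h0
          rw [mul_inv]
          refine mul_le_mul_of_nonneg_left (inv_anti₀ (by positivity) ?_) (by positivity)
          nlinarith
      calc (4 * Real.pi * ‖y - x‖)⁻¹ * |G x| ≤ ((4 * Real.pi)⁻¹ * (‖y - x‖ ^ 2)⁻¹) * B :=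
            mul_le_mul hle (hB x) (abs_nonneg _) (by positivity)
        _ = (4 * Real.pi)⁻¹ * (B * (‖y - x‖ ^ 2)⁻¹) := by ring
        _ ≤ (4 * Real.pi)⁻¹ * (B * (‖y - x‖ ^ 2)⁻¹ + |G x|) :=
            mul_le_mul_of_nonneg_left (le_add_of_nonneg_right (abs_nonneg _)) (by positivity)
    · rw [if_neg h1, mul_zero, zero_add]
      rw [not_lt] at h1
      have hle : (4 * Real.pi * ‖y - x‖)⁻¹ ≤ (4 * Real.pi)⁻¹ := by
        refine inv_anti₀ (by positivity) ?_
        nlinarith [Real.pi_pos]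
      exact mul_le_mul_of_nonneg_right hle (abs_nonneg _)
  calc |∫ x, newtonKernel (y - x) * G x| ≤ ∫ x, |newtonKernel (y - x) * G x| :=
        abs_integral_le_integral_abs
    _ ≤ ∫ x, (4 * Real.pi)⁻¹ * (B * nearProfile₂ 1 ‖y - x‖ + |G x|) :=
        integral_mono_of_nonneg (Eventually.of_forall fun x => abs_nonneg _) hmaj
          (Eventually.of_forall hpt)
    _ = B + (4 * Real.pi)⁻¹ * ∫ x, |G x| := by
        rw [integral_const_mul, integral_add (((integrable_nearProfile₂_norm one_pos).comp_sub_left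
            y).const_mul B) hGi.abs, integral_const_mul,
          integral_sub_left_eq_self (fun z : EuclideanSpace ℝ (Fin 3) => nearProfile₂ 1 ‖z‖) volume y,
          integral_nearProfile₂_norm_eq one_pos]
        field_simp

/-- **Gradient bound for the Newtonian potential of a test function**:
`‖D(∫ Γ(· − x) G(x) dx)(y)‖ ≤ B₁ + (4π)⁻¹ ∫ ‖DG‖` for `‖DG‖ ≤ B₁`. [folklore] -/
theorem norm_fderiv_integral_newtonKernel_mul_le (hG : ContDiff ℝ (⊤ : ℕ∞) G)
    (hGc : HasCompactSupport G) {B₁ : ℝ} (hB₁ : ∀ x, ‖fderiv ℝ G x‖ ≤ B₁)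
    (y : EuclideanSpace ℝ (Fin 3)) :
    ‖fderiv ℝ (fun y => ∫ x, newtonKernel (y - x) * G x) y‖ ≤
      B₁ + (4 * Real.pi)⁻¹ * ∫ x, ‖fderiv ℝ G x‖ := by
  have hB10 : 0 ≤ B₁ := (norm_nonneg _).trans (hB₁ 0)
  have hG1 : ContDiff ℝ 1 G := contDiff_infty.1 hG 1
  have hDGi : Integrable fun x => ‖fderiv ℝ G x‖ :=
    ((hG1.continuous_fderiv one_ne_zero).norm).integrable_of_hasCompactSupport
      (hGc.fderiv (𝕜 := ℝ)).norm
  refine ContinuousLinearMap.opNorm_le_bound _ (by positivity) fun a => ?_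
  rw [fderiv_integral_newtonKernel_mul_apply hG hGc y a, Real.norm_eq_abs]
  have hGa : Continuous fun x => fderiv ℝ G x a :=
    (hG1.continuous_fderiv one_ne_zero).clm_apply continuous_const
  have h := abs_integral_newtonKernel_mul_le hGa (hGc.fderiv_apply (𝕜 := ℝ) a)
    (B := B₁ * ‖a‖) (fun x => by
      rw [← Real.norm_eq_abs]
      exact (ContinuousLinearMap.le_opNorm _ _).trans
        (mul_le_mul_of_nonneg_right (hB₁ x) (norm_nonneg _))) y
  refine h.trans ?_
  have h2 : ∫ x, |fderiv ℝ G x a| ≤ ∫ x, ‖fderiv ℝ G x‖ * ‖a‖ :=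
    integral_mono_of_nonneg (Eventually.of_forall fun x => abs_nonneg _) (hDGi.mul_const _)
      (Eventually.of_forall fun x => by
        show |fderiv ℝ G x a| ≤ ‖fderiv ℝ G x‖ * ‖a‖
        rw [← Real.norm_eq_abs]
        exact ContinuousLinearMap.le_opNorm _ _)
  rw [integral_mul_const] at h2
  have h3 : 0 ≤ ∫ x, ‖fderiv ℝ G x‖ := integral_nonneg fun x => norm_nonneg _
  nlinarith [Real.pi_pos, inv_nonneg.2 (by positivity : (0 : ℝ) ≤ 4 * Real.pi),
    mul_le_mul_of_nonneg_left h2 (inv_nonneg.2 (by positivity : (0 : ℝ) ≤ 4 * Real.pi))]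

end Potential

/-! ### The gradient term of the curl-type pairing vanishes for weakly divergence-free fields -/

section Conclusion

-- nested operator types
set_option maxSynthPendingDepth 3

variable {g : EuclideanSpace ℝ (Fin 3) → ℝ}

/-- **The inner integral of the curl-type pairing is a gradient**: for a test function `g` and a
vector `V₀`, `∫ ∂_{V₀}Γ(y − x) ∇g(x) dx = ∇H(y)` with `H = Γ * (∂_{V₀}g)` the Newtonian potential
of `∂_{V₀}g` (distributional gradient of `Γ`, symmetry of second derivatives of `g`, and
`∂ₐ(Γ * G) = Γ * ∂ₐG`). [folklore] -/
theorem integral_fderiv_newtonKernel_smul_gradient_eq_gradient (hg : ContDiff ℝ (⊤ : ℕ∞) g)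
    (hgc : HasCompactSupport g) (V₀ y : EuclideanSpace ℝ (Fin 3)) :
    ∫ x, (fderiv ℝ newtonKernel (y - x) V₀) • gradient g x =
      gradient (fun y => ∫ x, newtonKernel (y - x) * fderiv ℝ g x V₀) y := by
  have hg2 : ContDiff ℝ 2 g := contDiff_infty.1 hg 2
  have hg1 : ContDiff ℝ 1 g := contDiff_infty.1 hg 1
  have hG : ContDiff ℝ (⊤ : ℕ∞) fun x => fderiv ℝ g x V₀ := by
    refine contDiff_infty.2 fun n => ?_
    exact (hg.fderiv_right (m := n) (by exact_mod_cast le_top)).clm_apply contDiff_const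
  have hGc : HasCompactSupport fun x => fderiv ℝ g x V₀ := hgc.fderiv_apply (𝕜 := ℝ) V₀
  have hgrad : Continuous (gradient g) := FluidPDE.continuous_gradient_of_contDiff hg1
  have hgradc : HasCompactSupport (gradient g) :=
    (hgc.fderiv (𝕜 := ℝ)).comp_left
      (g := (InnerProductSpace.toDual ℝ (EuclideanSpace ℝ (Fin 3))).symm) (map_zero _)
  have hint := integrable_fderiv_newtonKernel_smul hgrad hgradc y V₀
  refine ext_inner_right ℝ fun a => ?_
  -- right: `⟪∇H(y), a⟫ = ∂ₐH(y) = ∫ Γ(y - x) ∂ₐ(∂_{V₀} g)(x)`; left: move `a` inside the integral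
  rw [gradient, InnerProductSpace.toDual_symm_apply,
    fderiv_integral_newtonKernel_mul_apply hG hGc y a,
    real_inner_comm a (∫ x, (fderiv ℝ newtonKernel (y - x) V₀) • gradient g x),
    ← integral_inner hint a]
  have e1 : ∀ x, ⟪a, (fderiv ℝ newtonKernel (y - x) V₀) • gradient g x⟫ =
      (fderiv ℝ newtonKernel (y - x) V₀) • fderiv ℝ g x a := fun x => by
    rw [real_inner_smul_right, real_inner_comm, gradient, InnerProductSpace.toDual_symm_apply,
      smul_eq_mul]
  simp_rw [e1]
  have hga : ContDiff ℝ 1 fun x => fderiv ℝ g x a :=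
    (hg2.fderiv_right (m := 1) le_rfl).clm_apply contDiff_const
  rw [← integral_newtonKernel_smul_fderiv_eq hga (hgc.fderiv_apply (𝕜 := ℝ) a) y V₀]
  refine integral_congr_ae (Eventually.of_forall fun x => ?_)
  simp only [smul_eq_mul]
  rw [fderiv_fderiv_apply_comm hg2 x a V₀]

variable {ω : EuclideanSpace ℝ (Fin 3) → EuclideanSpace ℝ (Fin 3)}

/-- **The gradient term of the curl-type pairing of `K₃ * ω` vanishes** when `ω ∈ L¹` is weakly
divergence free: `∫ ⟪ω(y), ∫ ∂_{V₀}Γ(y − x) ∇g(x) dx⟫ dy = 0` (the inner integral is the gradient of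
the smooth bounded function `Γ * ∂_{V₀}g` with bounded gradient, and weakly divergence-free `L¹`
fields annihilate such gradients, `integral_inner_gradient_eq_zero_of_bounded`). With
`BiotSavartCurlPair.integral_inner_biotSavart_curlPair_eq` this gives
`∫ ⟪K₃ * ω, (∂ₐg) c − (∂_c g) a⟫ = ∫ g ⟪ω, c × a⟫`. [folklore] -/
theorem IsWeaklyDivFree.integral_inner_integral_fderiv_newtonKernel_smul_gradient_eq_zero
    (hωi : Integrable ω) (hdiv : IsWeaklyDivFree ω) (hg : ContDiff ℝ (⊤ : ℕ∞) g)
    (hgc : HasCompactSupport g) (V₀ : EuclideanSpace ℝ (Fin 3)) :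
    ∫ y, ⟪ω y, ∫ x, (fderiv ℝ newtonKernel (y - x) V₀) • gradient g x⟫ = 0 := by
  simp_rw [integral_fderiv_newtonKernel_smul_gradient_eq_gradient hg hgc V₀]
  have hG : ContDiff ℝ (⊤ : ℕ∞) fun x => fderiv ℝ g x V₀ := by
    refine contDiff_infty.2 fun n => ?_
    exact (hg.fderiv_right (m := n) (by exact_mod_cast le_top)).clm_apply contDiff_const
  have hGc : HasCompactSupport fun x => fderiv ℝ g x V₀ := hgc.fderiv_apply (𝕜 := ℝ) V₀
  have hG1 : ContDiff ℝ 1 fun x => fderiv ℝ g x V₀ := contDiff_infty.1 hG 1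
  obtain ⟨BG, hBG⟩ := hG.continuous.bounded_above_of_compact_support hGc
  obtain ⟨BDG, hBDG⟩ := (hG1.continuous_fderiv one_ne_zero).bounded_above_of_compact_support
    (hGc.fderiv (𝕜 := ℝ))
  refine hdiv.integral_inner_gradient_eq_zero_of_bounded hωi
    (contDiff_integral_newtonKernel_mul hG hGc)
    (B₀ := BG + (4 * Real.pi)⁻¹ * ∫ x, |fderiv ℝ g x V₀|)
    (B₁ := BDG + (4 * Real.pi)⁻¹ * ∫ x, ‖fderiv ℝ (fun x => fderiv ℝ g x V₀) x‖)
    (fun y => abs_integral_newtonKernel_mul_le hG.continuous hGc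
      (fun x => by rw [← Real.norm_eq_abs]; exact hBG x) y)
    (fun y => norm_fderiv_integral_newtonKernel_mul_le hG hGc hBDG y)

end Conclusion

end Literature.Analysis.FluidPDE
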